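import Summits.BirchSwinnertonDyer.BirchSwinnertonDyer.Theorems.ResidualThetaTransportAtTwoResidualSignedLambdaLowerCMAtTwoSelmerSubmodules
import Literature.NumberTheory.EllipticCurves.SupersingularModPDecompositionImageProofs
import HarnessLib

/-!
# The STRICT-at-2 submodule of a Selmer module of `A_ρ` (the `Sel₀` of the N5 duality lemma): the transported Kummer clause with the
# TRIVIAL point subgroup is an `𝒪`-submodule condition

Route `ResidualThetaTransportAtTwo` (RTT), crux RSL_g `ResidualSignedLambdaLowerCMAtTwo` (stmt-BirchSwinnertonDyer-22608; the (R≥)ᵖ crux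
stmt-BirchSwinnertonDyer-26074 is glue above it); registered line «duality» (skeleton v1, 266657094df02bca): the strict submodule `Sel₀` fed to
`CharIdealLambda.le_finrank_baseChange_characterModule_of_duality` ((ORTH) and the flank `λ(H/Z) ≤ λ(Sel₀⋆)`). Seat `prover-bsd-wall-rtt-p2` g16
(`--supports`, closes nothing). THEOREMS ONLY (no definition, no named fact, no instance, no `sorry`); BSD is not proved by any of this.

WHAT. The crux's local clause at `v ∣ 2` is «`∃ φ Q k, [φ] = conj_σ y ∧ (∀ i, 2^k Q_i ∈ L) ∧ Θ_v(φ|_{U_v}) = ∂Q`» with `L = ⨆_m E⁺_m`; the STRICT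
clause is the same with `L = ⊥` (`Q_i` torsion, i.e. the restricted class is a coboundary in `A_ρ ≅_Θ W[2^∞]ⁿ`). w3's
`exists_addSubgroup_transportedKummer` / `transportedKummer_conj_scalarH1` are stated for ANY `L`, so with `L := ⊥` and Serre 1972 Prop. 12
DISCHARGED (`serre1972_supersingular_decompositionSubgroup_image_holds`):
* **`exists_submodule_strictAt`** — for one place `v ∋ 2` and a Selmer module `Sg` (scalarH1 `𝒪`-structure), the strict classes form an
  `𝒪`-SUBMODULE of `Sg`; **`exists_submodule_strictAtTwo`** — the same for the datum `Θ : ∀ v ∋ 2, …` of RSL_g (all places over `2` at once);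
  both membership-characterised verbatim in the crux's vocabulary, conj-stability built in (all `σ`).

References: [Kobayashi2003] Def. 1.1, Thm. 7.3 ((7.21): the strict/fine term); [SerreInventiones1972] §1.11 Prop. 12; [EmertonPollackWeston2006] §3.1.
-/

set_option autoImplicit false
-- the Theorems namespace of this sub repeats the summit name by design (D-0017 nested layout)
set_option linter.dupNamespace false

noncomputable section

open scoped Classical

namespace Summit.BirchSwinnertonDyer.BirchSwinnertonDyer.Theorems.ThetaTransport

open WeierstrassCurve NumberField Field IsDedekindDomain Literature Literature.NumberTheory.EllipticCurves
  Literature.NumberTheory.EllipticCurves.GreenbergSelmer Literature.NumberTheory.GaloisRepresentations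
  Literature.NumberTheory.EllipticCurves.Rank1Residual

variable (W : WeierstrassCurve ℚ) [W.IsElliptic] [W.IsGloballyMinimal] {p : ℕ} [Fact p.Prime] (S : Set (PadicAlgCl p)) {m : ℕ}
  (κ : ZpExtension ℚ 2) (ρ : FramedGaloisRep ℚ ↥(padicCoeffIntegers S) m)

/-- **The strict-at-`v` classes form an `𝒪`-submodule.** On the habitat (`GoodSS W 2`, `a₂ = 0`), for `v ∋ 2`, a `D_v`-equivariant
`Θ : A_ρ ≃+ (W[2^∞])ⁿ` and a Selmer module `Sg ≤ H¹(Γ_{ℚ_∞}, A_ρ)` with its scalarH1 `𝒪`-structure: `{s ∈ Sg | ∀ σ, ∃ φ Q k, [φ] = conj_σ s ∧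
(∀ i, 2^k Q_i ∈ ⊥) ∧ Θ(φ|_{U_v}) = ∂Q}` is a `Submodule 𝒪 Sg` (w3's transported-Kummer subgroup with `L = ⊥`, `𝒪`-stable by
`transportedKummer_conj_scalarH1`, Serre discharged). [cite: Kobayashi2003, Def. 1.1 and Thm. 7.3 ((7.21), p. 13)] [cite: SerreInventiones1972, §1.11 Prop. 12] -/
theorem exists_submodule_strictAt (hss : GoodSS W 2) (ha2 : W.frobeniusTrace 2 = 0) (v : HeightOneSpectrum (𝓞 ℚ))
    (hv : ((2 : ℕ) : 𝓞 ℚ) ∈ v.asIdeal) {n : ℕ} (Θ : Cofree ρ ↥(padicCoeffField S) ≃+ (Fin n → ↥(W.geomPrimaryTorsion 2)))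
    (hΘ : ∀ (δ : absoluteGaloisGroup (v.adicCompletion ℚ)) (x : Cofree ρ ↥(padicCoeffField S)) (i : Fin n),
      Θ (resGalOfEmb (closureEmb (K := ℚ) (v.adicCompletion ℚ)) δ • x) i = resGalOfEmb (closureEmb (K := ℚ) (v.adicCompletion ℚ)) δ • Θ x i)
    (Sg : AddSubgroup (subgroupH1 κ.kerSubgroup (Cofree ρ ↥(padicCoeffField S)))) [Module ↥(padicCoeffIntegers S) Sg]
    (hsmul : ∀ (r : ↥(padicCoeffIntegers S)) (s : Sg),
      ((r • s : Sg) : subgroupH1 κ.kerSubgroup (Cofree ρ ↥(padicCoeffField S))) =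
        scalarH1 κ.kerSubgroup (Cofree ρ ↥(padicCoeffField S)) r s) :
    ∃ Str : Submodule ↥(padicCoeffIntegers S) Sg, ∀ s : Sg, s ∈ Str ↔ ∀ σ : absoluteGaloisGroup ℚ,
      ∃ (φ : contOneCocycles (discreteTopRep κ.kerSubgroup (Cofree ρ ↥(padicCoeffField S))))
        (Q : Fin n → localPoints W (v.adicCompletion ℚ)) (k : ℕ),
        oneCocycleClass (discreteTopRep κ.kerSubgroup (Cofree ρ ↥(padicCoeffField S))) φ =
          conjH1 κ.kerSubgroup (Cofree ρ ↥(padicCoeffField S)) σ (s : subgroupH1 κ.kerSubgroup (Cofree ρ ↥(padicCoeffField S))) ∧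
        (∀ i, (2 ^ k) • Q i ∈ (⊥ : AddSubgroup (localPoints W (v.adicCompletion ℚ)))) ∧
        ∀ (τ : localSubgroupOfEmb κ.kerSubgroup (closureEmb (K := ℚ) (v.adicCompletion ℚ))) (i : Fin n),
          pointsMapOfEmb W (closureEmb (K := ℚ) (v.adicCompletion ℚ))
            ((Θ (φ.1 (resGalSubgroupOfEmb κ.kerSubgroup (closureEmb (K := ℚ) (v.adicCompletion ℚ)) τ)) i : ↥(W.geomPrimaryTorsion 2)) :
              W.geomPoints) = (τ : absoluteGaloisGroup (v.adicCompletion ℚ)) • Q i - Q i := by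
  refine (exists_addSubgroup_transportedKummer W κ.kerSubgroup v Θ (⊥ : AddSubgroup (localPoints W (v.adicCompletion ℚ)))).elim
    fun Sv hSv ↦ ?_
  refine ⟨{ carrier := {s : Sg | (s : subgroupH1 κ.kerSubgroup (Cofree ρ ↥(padicCoeffField S))) ∈ Sv}
            zero_mem' := by rw [Set.mem_setOf_eq, ZeroMemClass.coe_zero]; exact Sv.zero_mem
            add_mem' := fun {a b} ha hb ↦ by rw [Set.mem_setOf_eq, AddSubgroup.coe_add]; exact Sv.add_mem ha hb
            smul_mem' := fun r s hs ↦ ?_ }, fun s ↦ hSv s⟩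
  rw [Set.mem_setOf_eq, hsmul, hSv]
  exact transportedKummer_conj_scalarH1 W serre1972_supersingular_decompositionSubgroup_image_holds hss ha2 v hv κ.kerSubgroup
    κ.isClosed_kerSubgroup Θ hΘ ⊥ r _ ((hSv _).1 hs)

/-- **The strict-at-`2` submodule for the full datum `Θ : ∀ v ∋ 2, A_ρ ≃+ (W[2^∞])ⁿ` of RSL_g**: the classes of `Sg` strict at EVERY place over `2`
form ONE `Submodule 𝒪 Sg` (intersection over `(v, hv)` of `exists_submodule_strictAt`). This is the `Sel₀` of the N5 duality lemma in the
crux's own vocabulary. [cite: Kobayashi2003, Thm. 7.3 ((7.21), p. 13)] [cite: SerreInventiones1972, §1.11 Prop. 12] -/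
theorem exists_submodule_strictAtTwo (hss : GoodSS W 2) (ha2 : W.frobeniusTrace 2 = 0) {n : ℕ}
    (Θ : ∀ v : HeightOneSpectrum (𝓞 ℚ), ((2 : ℕ) : 𝓞 ℚ) ∈ v.asIdeal →
      (Cofree ρ ↥(padicCoeffField S) ≃+ (Fin n → ↥(W.geomPrimaryTorsion 2))))
    (hΘ : ∀ (v : HeightOneSpectrum (𝓞 ℚ)) (hv : ((2 : ℕ) : 𝓞 ℚ) ∈ v.asIdeal) (δ : absoluteGaloisGroup (v.adicCompletion ℚ))
      (x : Cofree ρ ↥(padicCoeffField S)) (i : Fin n),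
      Θ v hv (resGalOfEmb (closureEmb (K := ℚ) (v.adicCompletion ℚ)) δ • x) i =
        resGalOfEmb (closureEmb (K := ℚ) (v.adicCompletion ℚ)) δ • Θ v hv x i)
    (Sg : AddSubgroup (subgroupH1 κ.kerSubgroup (Cofree ρ ↥(padicCoeffField S)))) [Module ↥(padicCoeffIntegers S) Sg]
    (hsmul : ∀ (r : ↥(padicCoeffIntegers S)) (s : Sg),
      ((r • s : Sg) : subgroupH1 κ.kerSubgroup (Cofree ρ ↥(padicCoeffField S))) =
        scalarH1 κ.kerSubgroup (Cofree ρ ↥(padicCoeffField S)) r s) :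
    ∃ Str : Submodule ↥(padicCoeffIntegers S) Sg, ∀ s : Sg, s ∈ Str ↔
      ∀ (v : HeightOneSpectrum (𝓞 ℚ)) (hv : ((2 : ℕ) : 𝓞 ℚ) ∈ v.asIdeal) (σ : absoluteGaloisGroup ℚ),
      ∃ (φ : contOneCocycles (discreteTopRep κ.kerSubgroup (Cofree ρ ↥(padicCoeffField S))))
        (Q : Fin n → localPoints W (v.adicCompletion ℚ)) (k : ℕ),
        oneCocycleClass (discreteTopRep κ.kerSubgroup (Cofree ρ ↥(padicCoeffField S))) φ =
          conjH1 κ.kerSubgroup (Cofree ρ ↥(padicCoeffField S)) σ (s : subgroupH1 κ.kerSubgroup (Cofree ρ ↥(padicCoeffField S))) ∧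
        (∀ i, (2 ^ k) • Q i ∈ (⊥ : AddSubgroup (localPoints W (v.adicCompletion ℚ)))) ∧
        ∀ (τ : localSubgroupOfEmb κ.kerSubgroup (closureEmb (K := ℚ) (v.adicCompletion ℚ))) (i : Fin n),
          pointsMapOfEmb W (closureEmb (K := ℚ) (v.adicCompletion ℚ))
            ((Θ v hv (φ.1 (resGalSubgroupOfEmb κ.kerSubgroup (closureEmb (K := ℚ) (v.adicCompletion ℚ)) τ)) i :
              ↥(W.geomPrimaryTorsion 2)) : W.geomPoints) = (τ : absoluteGaloisGroup (v.adicCompletion ℚ)) • Q i - Q i := by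
  have h := fun (v : HeightOneSpectrum (𝓞 ℚ)) (hv : ((2 : ℕ) : 𝓞 ℚ) ∈ v.asIdeal) ↦
    exists_submodule_strictAt W S κ ρ hss ha2 v hv (Θ v hv) (hΘ v hv) Sg hsmul
  choose Str hStr using h
  refine ⟨⨅ (v : HeightOneSpectrum (𝓞 ℚ)) (hv : ((2 : ℕ) : 𝓞 ℚ) ∈ v.asIdeal), Str v hv, fun s ↦ ?_⟩
  simp only [Submodule.mem_iInf]
  exact forall_congr' fun v ↦ forall_congr' fun hv ↦ hStr v hv s

end Summit.BirchSwinnertonDyer.BirchSwinnertonDyer.Theorems.ThetaTransport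

end
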